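import Literature.NumberTheory.PAdicHodge.FontaineDpst
import Literature.NumberTheory.PAdicHodge.BdRSemiInvariantPeriodVector
import Literature.NumberTheory.GaloisRepresentations.AdmissiblePeriodVector
import Literature.NumberTheory.GaloisRepresentations.FramedRepBaseChange
import Literature.NumberTheory.GaloisRepresentations.PstWeilDeligneTwistDeRham
import HarnessLib

/-!
# A de Rham character has a semi-invariant vector in `ℂ_F^κ` (regular-representation coordinates)

`Proofs`-style file (theorems only: no definition, no named fact, no instance).

**What is printed.**  Fontaine, Astérisque 223, Exp. III §1.5 with Exp. II §1.5: a `B_dR`-admissible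
(= de Rham) `ℚ_p`-representation `V` of `Γ_F` has `dim_F D_dR(V) = dim V`, in particular a nonzero
period vector `β ∈ B_dR^κ` in a basis of `V`, semi-invariant for the contragredient matrices; reducing a
suitable multiple `u^{-m} β ∈ (B_dR⁺)^κ ∖ (u B_dR⁺)^κ` through `θ : B_dR⁺ → ℂ_F` (`σ u = k_σ u`,
`θ(k_σ) = χ(σ)`) gives a nonzero vector of `ℂ_F^κ` semi-invariant for the `χ^{-m}`-twisted matrices —
the first step of "de Rham ⇒ Hodge–Tate" (Fontaine–Ouyang, Thm. 5.2.6 (3)).  For a CHARACTER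
`r : Γ_F → E×` with `E/ℚ_p` finite, viewed `ℚ_p`-linearly on `V = E` with a `ℚ_p`-basis `b` of `E`,
the matrices are the regular-representation matrices `L_b(r(σ))` (Serre 1968, Ch. III App. A: an
`E`-valued character is a `ℚ_p`-representation of dimension `[E : ℚ_p]`).

**What is proved here** (for the tree's `bdRPeriodRingData`, `restrictScalarsQl`, `fontainePst`):
* `apply_eq_algebraMap_of_hasQlModel` — a rank-one `r : Γ → GL₁(ℚ̄_p)` with model `rE` over `E` has
  `r(g)₀₀ = rE(g)₀₀` in `ℚ̄_p`;
* `exists_hasQlModel_isDeRham_bdR_of_isDeRhamFramed` (+ `…_of_fontainePst`) — unpacking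
  `IsDeRhamFramed` for a datum whose period ring is `B_dR(F)`: a finite model admissible for
  `bdRPeriodRingData`;
* `toMatrix_restrictScalarsQl_eq_leftMulMatrix` — in the basis `b` of `E = (Fin 1 → E)`, the matrix of
  `restrictScalarsQl E rE σ` is `Algebra.leftMulMatrix b (rE σ)₀₀`;
* `exists_semiInvariant_of_isDeRham_bdR` — **for `rE : Γ_F → GL₁(E)` with `restrictScalarsQl E rE`
  de Rham for `B_dR(F)` and a `ℚ_p`-basis `b` of `E`: some `m : ℤ` and `x ∈ ℂ_F^κ ∖ 0` with
  `σ • x = χ(σ)^{-m} · L_b(rE(σ⁻¹)₀₀) x` for all `σ ∈ Γ_F`**;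
* `exists_model_semiInvariant_of_isDeRhamFramed` — the same from `(fontainePst F p hp).IsDeRhamFramed r`
  for `r : Γ_F → GL₁(ℚ̄_p)`, together with `r(σ)₀₀ = rE(σ)₀₀`.

## References

* J.-M. Fontaine, *Le corps des périodes p-adiques*; *Représentations p-adiques semi-stables*,
  Astérisque 223 (1994), Exp. II §1.5, Exp. III §1.5. [`FontaineAsterisque223III`]
* J.-M. Fontaine, Y. Ouyang, *Theory of p-adic Galois representations*, Thm. 2.13, Thm. 5.2.6.
  [`FontaineOuyang2022`]
* J.-P. Serre, *Abelian ℓ-adic representations and elliptic curves* (1968), Ch. III, App. A.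
  [`SerreAbelianLadic1968`]
-/

noncomputable section

open Field ValuativeRel Matrix
open scoped MatrixGroups

namespace Literature.NumberTheory.PAdicHodge

open Literature.NumberTheory.GaloisRepresentations
open Literature.NumberTheory.GaloisRepresentations.IsNonarchimedeanLocalField
open Literature.NumberTheory.Automorphic

namespace DeRhamRankOne

/-! ### Rank-one models -/

section Model

variable {K : Type} [Field K] {ℓ : ℕ} [Fact ℓ.Prime]

/-- **`r(g)₀₀ = rE(g)₀₀` for a rank-one model**: conjugation is trivial on `1 × 1` matrices and
extension of scalars is the inclusion `E ⊆ ℚ̄_ℓ` on entries (the accepted `HasQlModel.coe_det_apply`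
read through `det = (·)₀₀`). [cite: BuzzardGeeLMS2014, §2.2] -/
theorem apply_eq_algebraMap_of_hasQlModel {r : FramedGaloisRep K (PadicAlgCl ℓ) 1}
    {E : IntermediateField ℚ_[ℓ] (PadicAlgCl ℓ)} {rE : FramedGaloisRep K E 1}
    (h : HasQlModel r E rE) (g : absoluteGaloisGroup K) :
    ((r g : GL (Fin 1) (PadicAlgCl ℓ)) : Matrix (Fin 1) (Fin 1) (PadicAlgCl ℓ)) 0 0 =
      algebraMap E (PadicAlgCl ℓ) ((((rE g : GL (Fin 1) E)) : Matrix (Fin 1) (Fin 1) E) 0 0) := by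
  have h1 := h.coe_det_apply g
  rw [FramedRep.det_apply, FramedRep.det_apply, Matrix.GeneralLinearGroup.val_det_apply,
    Matrix.GeneralLinearGroup.val_det_apply, Matrix.det_fin_one, Matrix.det_fin_one] at h1
  exact h1

end Model

/-! ### Unpacking `IsDeRhamFramed` for a datum whose period ring is `B_dR(F)` -/

section Cast

variable {F : Type} [Field F] [ValuativeRel F] [TopologicalSpace F] [IsNonarchimedeanLocalField F]
  [CharZero F] {p : ℕ} [Fact p.Prime] (hp : valuation F p < 1)

/-- **A de Rham `r` has a finite model admissible for `B_dR(F)`** — for every datum `𝔇` whose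
period ring is `bdRPeriodRingData` and whose `ℚ_p`-structure is the ambient one (unfolding of
`IsDeRhamFramed` / `FramedRep.IsDeRhamWith`). [cite: FontaineAsterisque223III, Exp. III §1.5 and §3] -/
theorem exists_hasQlModel_isDeRham_bdR_of_isDeRhamFramed [Algebra ℚ_[p] F]
    [Fact (¬ IsUnit ((p : ℕ) : integerC F))]
    [IsAdicComplete (Ideal.span {((p : ℕ) : integerC F)}) (integerC F)]
    (𝔇 : PstWeilDeligneData F p) (halg : 𝔇.algebra = ‹Algebra ℚ_[p] F›)
    (h𝔅 : 𝔇.𝔅 = (letI := 𝔇.algebra; bdRPeriodRingData (F := F) (p := p) hp))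
    {n : ℕ} {r : FramedRep (absoluteGaloisGroup F) (PadicAlgCl p) n} (hr : 𝔇.IsDeRhamFramed r) :
    ∃ (E : IntermediateField ℚ_[p] (PadicAlgCl p)) (_ : FiniteDimensional ℚ_[p] E)
      (rE : FramedRep (absoluteGaloisGroup F) E n),
      HasQlModel r E rE ∧ (restrictScalarsQl E rE).IsDeRham (bdRPeriodRingData (F := F) (p := p) hp) := by
  subst halg
  obtain ⟨E, hE, rE, hmodel, hdR⟩ := hr
  refine ⟨E, hE, rE, hmodel, ?_⟩
  rw [h𝔅] at hdR
  exact hdR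

/-- **The same for THE datum `fontainePst F p hp`** (its period ring is `B_dR(F)` and its
`ℚ_p`-structure the canonical `LocalField.padicAlgebra`: accepted `fontainePst_𝔅_eq_bdRPeriodRingData`,
`fontainePst_algebra_eq_padicAlgebra`). [cite: FontaineAsterisque223III, Exp. III §1.5 and §3] -/
theorem exists_hasQlModel_isDeRham_bdR_of_fontainePst {n : ℕ}
    {r : FramedRep (absoluteGaloisGroup F) (PadicAlgCl p) n} (hr : (fontainePst F p hp).IsDeRhamFramed r) :
    letI := LocalField.padicAlgebra F p hp
    haveI : Fact (¬ IsUnit ((p : ℕ) : integerC F)) := ⟨not_isUnit_natCast_integerC hp⟩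
    haveI : IsAdicComplete (Ideal.span {((p : ℕ) : integerC F)}) (integerC F) :=
      isAdicComplete_integerC_natCast hp
    ∃ (E : IntermediateField ℚ_[p] (PadicAlgCl p)) (_ : FiniteDimensional ℚ_[p] E)
      (rE : FramedRep (absoluteGaloisGroup F) E n),
      HasQlModel r E rE ∧ (restrictScalarsQl E rE).IsDeRham (bdRPeriodRingData (F := F) (p := p) hp) := by
  letI := LocalField.padicAlgebra F p hp
  haveI : Fact (¬ IsUnit ((p : ℕ) : integerC F)) := ⟨not_isUnit_natCast_integerC hp⟩
  haveI : IsAdicComplete (Ideal.span {((p : ℕ) : integerC F)}) (integerC F) :=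
    isAdicComplete_integerC_natCast hp
  exact exists_hasQlModel_isDeRham_bdR_of_isDeRhamFramed hp (fontainePst F p hp)
    (fontainePst_algebra_eq_padicAlgebra hp) (fontainePst_𝔅_eq_bdRPeriodRingData hp) hr

end Cast

/-! ### The matrix of `restrictScalarsQl E rE` in a basis of `E` -/

section Matrix

variable {K : Type} [Field K] {ℓ : ℕ} [Fact ℓ.Prime]
  {E : IntermediateField ℚ_[ℓ] (PadicAlgCl ℓ)} (rE : FramedGaloisRep K E 1)
  {κ : Type*} [Fintype κ] [DecidableEq κ] (b : Module.Basis κ ℚ_[ℓ] E)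

/-- **Regular-representation matrices**: along the basis `k ↦ (b_k) ∈ (Fin 1 → E)` induced by a
`ℚ_ℓ`-basis `b` of `E`, the matrix of `restrictScalarsQl E rE σ` (multiplication by `rE(σ)₀₀` on `E`)
is `Algebra.leftMulMatrix b (rE(σ)₀₀)`. [cite: SerreAbelianLadic1968, Ch. III App. A] -/
theorem toMatrix_restrictScalarsQl_eq_leftMulMatrix (σ : absoluteGaloisGroup K) :
    LinearMap.toMatrix (b.map (LinearEquiv.funUnique (Fin 1) ℚ_[ℓ] E).symm)
        (b.map (LinearEquiv.funUnique (Fin 1) ℚ_[ℓ] E).symm) (restrictScalarsQl E rE σ) =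
      Algebra.leftMulMatrix b ((((rE σ : GL (Fin 1) E)) : Matrix (Fin 1) (Fin 1) E) 0 0) := by
  set e := LinearEquiv.funUnique (Fin 1) ℚ_[ℓ] E with he
  have hbk : ∀ k, (b.map e.symm k) 0 = b k := fun k => by
    rw [Module.Basis.map_apply]
    exact e.apply_symm_apply (b k)
  ext j k
  rw [LinearMap.toMatrix_apply, Algebra.leftMulMatrix_eq_repr_mul]
  change b.repr (e.symm.symm (restrictScalarsQl E rE σ (b.map e.symm k))) j = _
  rw [LinearEquiv.symm_symm, restrictScalarsQl_apply_apply, FramedRep.toContinuousRep_apply_apply]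
  change b.repr ((((rE σ : GL (Fin 1) E) : Matrix (Fin 1) (Fin 1) E) *ᵥ (b.map e.symm k)) 0) j = _
  rw [Matrix.mulVec, dotProduct, Fin.sum_univ_one, hbk]

end Matrix

/-! ### The semi-invariant vector of a de Rham character -/

section SemiInvariant

variable {F : Type} [Field F] [ValuativeRel F] [TopologicalSpace F] [IsNonarchimedeanLocalField F]
  [CharZero F] {p : ℕ} [Fact p.Prime] (hp : valuation F p < 1)

/-- **A `B_dR`-admissible character has a semi-invariant vector in `ℂ_F^κ`.**  Let `rE : Γ_F → GL₁(E)`,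
`E/ℚ_p` finite inside `ℚ̄_p`, with `restrictScalarsQl E rE` de Rham for `bdRPeriodRingData`, and let
`b` be a `ℚ_p`-basis of `E`.  Then there are `m : ℤ` and `x ∈ ℂ_F^κ`, `x ≠ 0`, with
`σ • x_k = χ(σ)^{-m} · Σ_j L_b(rE(σ⁻¹)₀₀)_{kj} x_j` for all `σ ∈ Γ_F`, `k` (the cyclotomic character
read in `F` through `LocalField.padicRingHom`, the matrix entries through `ℚ_p → F → ℂ_F`).
[cite: FontaineAsterisque223III, Exp. III §1.5, Exp. II §1.5.4] [cite: FontaineOuyang2022, Thm. 5.2.6] -/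
theorem exists_semiInvariant_of_isDeRham_bdR [Algebra ℚ_[p] F]
    [Fact (¬ IsUnit ((p : ℕ) : integerC F))]
    [IsAdicComplete (Ideal.span {((p : ℕ) : integerC F)}) (integerC F)]
    {E : IntermediateField ℚ_[p] (PadicAlgCl p)} [FiniteDimensional ℚ_[p] E]
    (rE : FramedRep (absoluteGaloisGroup F) E 1)
    (hdR : (restrictScalarsQl E rE).IsDeRham (bdRPeriodRingData (F := F) (p := p) hp))
    {κ : Type} [Fintype κ] [DecidableEq κ] (b : Module.Basis κ ℚ_[p] E) :
    ∃ (m : ℤ) (x : κ → CompletedAlgClosure F), x ≠ 0 ∧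
      ∀ σ k, σ • x k =
        (algebraMap F (CompletedAlgClosure F)
          (LocalField.padicRingHom F p hp
            (((GaloisRep.cyclotomicCharacter F p σ : ℤ_[p]ˣ) : ℤ_[p]) : ℚ_[p]))) ^ (-m) *
          ∑ j, algebraMap F (CompletedAlgClosure F) (algebraMap ℚ_[p] F
            (Algebra.leftMulMatrix b ((((rE σ⁻¹ : GL (Fin 1) E)) : Matrix (Fin 1) (Fin 1) E) 0 0) k j)) *
            x j := by
  classical
  have hF : Function.Surjective (WittVector.fontaineTheta (integerC F) p) :=
    surjective_fontaineTheta_integerC hp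
  haveI : IsDomain (BDeRhamPlus (integerC F) p) := isDomain_bDeRhamPlus hF
  haveI : FiniteDimensional ℚ_[p] (Fin 1 → E) := inferInstance
  haveI : Nontrivial (Fin 1 → E) := inferInstance
  -- a nonzero period vector, semi-invariant for the contragredient regular matrices
  have hD := PeriodRingData.exists_mem_D_ne_zero_of_isAdmissible
    (bdRPeriodRingData (F := F) (p := p) hp) (restrictScalarsQl E rE) hdR
  obtain ⟨β, hβ0, hβ⟩ := PeriodRingData.exists_ne_zero_forall_smul_eq_toMatrix_mulVec
    (bdRPeriodRingData (F := F) (p := p) hp) (restrictScalarsQl E rE)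
    (b.map (LinearEquiv.funUnique (Fin 1) ℚ_[p] E).symm) hD
  -- through `θ`
  refine BdRPeriodVector.exists_ne_zero_forall_smul_theta_eq hp hF
    (fun σ => (Algebra.leftMulMatrix b ((((rE σ⁻¹ : GL (Fin 1) E)) : Matrix (Fin 1) (Fin 1) E) 0 0)).map
      (algebraMap ℚ_[p] F)) (β := β) hβ0 fun σ k => ?_
  have h := congrFun (hβ σ) k
  rw [toMatrix_restrictScalarsQl_eq_leftMulMatrix] at h
  -- both sides agree definitionally (`bdRPeriodRingData_B`, `PeriodRingData.algebraMap_eq`,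
  -- `algebraMap_fracAlgebra`, `Matrix.mulVec`)
  convert h using 1 <;> rfl

/-- **The de Rham character of THE datum.**  For `r : Γ_F → GL₁(ℚ̄_p)` with
`(fontainePst F p hp).IsDeRhamFramed r` there are a finite `E ⊆ ℚ̄_p` and a model `rE : Γ_F → GL₁(E)`
with `r(σ)₀₀ = rE(σ)₀₀`, such that for every `ℚ_p`-basis `b` of `E` some nonzero `x ∈ ℂ_F^κ` and
`m : ℤ` satisfy `σ • x_k = χ(σ)^{-m} Σ_j L_b(rE(σ⁻¹)₀₀)_{kj} x_j` (all `ℚ_p`-structures canonical).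
[cite: FontaineAsterisque223III, Exp. III §1.5, Exp. II §1.5.4] [cite: FontaineOuyang2022, Thm. 5.2.6]
[cite: SerreAbelianLadic1968, Ch. III App. A] -/
theorem exists_model_semiInvariant_of_isDeRhamFramed
    (r : FramedRep (absoluteGaloisGroup F) (PadicAlgCl p) 1) (hr : (fontainePst F p hp).IsDeRhamFramed r) :
    ∃ (E : IntermediateField ℚ_[p] (PadicAlgCl p)) (_ : FiniteDimensional ℚ_[p] E)
      (rE : FramedRep (absoluteGaloisGroup F) E 1),
      (∀ σ, ((r σ : GL (Fin 1) (PadicAlgCl p)) : Matrix (Fin 1) (Fin 1) (PadicAlgCl p)) 0 0 =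
        algebraMap E (PadicAlgCl p) ((((rE σ : GL (Fin 1) E)) : Matrix (Fin 1) (Fin 1) E) 0 0)) ∧
      ∀ {κ : Type} [Fintype κ] [DecidableEq κ] (b : Module.Basis κ ℚ_[p] E),
        ∃ (m : ℤ) (x : κ → CompletedAlgClosure F), x ≠ 0 ∧
          ∀ σ k, σ • x k =
            (algebraMap F (CompletedAlgClosure F)
              (LocalField.padicRingHom F p hp
                (((GaloisRep.cyclotomicCharacter F p σ : ℤ_[p]ˣ) : ℤ_[p]) : ℚ_[p]))) ^ (-m) *
              ∑ j, algebraMap F (CompletedAlgClosure F) (LocalField.padicRingHom F p hp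
                (Algebra.leftMulMatrix b ((((rE σ⁻¹ : GL (Fin 1) E)) : Matrix (Fin 1) (Fin 1) E) 0 0) k j)) *
                x j := by
  letI := LocalField.padicAlgebra F p hp
  haveI : Fact (¬ IsUnit ((p : ℕ) : integerC F)) := ⟨not_isUnit_natCast_integerC hp⟩
  haveI : IsAdicComplete (Ideal.span {((p : ℕ) : integerC F)}) (integerC F) :=
    isAdicComplete_integerC_natCast hp
  obtain ⟨E, hE, rE, hmodel, hdR⟩ := exists_hasQlModel_isDeRham_bdR_of_fontainePst hp hr
  refine ⟨E, hE, rE, fun σ => apply_eq_algebraMap_of_hasQlModel hmodel σ, fun b => ?_⟩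
  exact exists_semiInvariant_of_isDeRham_bdR hp rE hdR b

end SemiInvariant

end DeRhamRankOne

end Literature.NumberTheory.PAdicHodge

end
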